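import Literature.IUT.HodgeTheaters.GoodLocalFrobenioidOfKitSplitNegative
import HarnessLib

/-!
# The divisor lattice of the REAL `C_v = C(ℚ_p)` inside `GoodLocalFrobenioid.ofKitQp p`: `Div_B(B) = ℤ·log(p)`

Mochizuki, *The geometry of Frobenioids II*, Kyushu J. Math. **62** (2008), §1, Example 1.1 (ii), p. 8
[cite: MochizukiFrdII2008, Ex 1.1 (ii) p.8]: "`B := B₀^Λ|_D ×_{(Φ₀^Λ)^gp|_D} Φ^gp → Φ^gp`", `Φ` absolutely primitive iff
"`Φ(K) ⊆ Λ · ord(ℚ_p^×)`"; [IUTchI] Example 3.3 (i) p. 78 [claim: Mochizuki2012, status: disputed]: "`Φ_{C⊢_v} : Spec(L) ↦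
ord(ℤ_{p_v}^▷) (⊆ ord(𝒪^▷_L)^pf)` … `C⊢_v ⊆ C_v`". abc-iut cell, seat abc-iut-w4-d047 (gen 2); DAG node `IUTchI:Ex3.3(iii)`
(row E33iii/d: input of `C⊢_v` "reconstructed category-theoretically from `F̲_v`" at the witness `ofKitQp p`).

Bookkeeping (concrete arithmetic of abc-iut-L1-t4's [FrdII] objects at `K_v = ℚ_p` over the one-object base; no new
mathematics, no statement of the papers):

* `pGen p A` — `log(p) = ord(p) ⊗ 1` as an element of `Φ_{C_v}(A) = ord(ℤ_p^▷)^pf`; `logpQ p A` — the same element of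
  `Φ_{C⊢_v}(A) = ℕ·ord(p)`; the inclusion `η : Φ_{C⊢_v} ↪ Φ_{C_v}` sends `logpQ` to `pGen` (`inclusionη_logpQ`);
* `divZeroHom_units_qp` — `Div₀(x) = Div₀(p)^{v_p(x)}` for `x ∈ ℚ_pˣ` (`ℚ_p^× = p^ℤ × ℤ_p^×`);
* `divB_eq_pGen_zpow` — **`Div_B(u) = log(p)^{v_p(u|_{K^×})}`** for every `u ∈ B(A)`: the divisor lattice
  `Div_B(B(A)) ⊆ Φ_{C_v}(A)^gp` is `ℤ·log(p)`, the image of `Φ_{C⊢_v}(A)^gp`;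
* `prim_gp_eq_zpow` — every element of `Φ_{C⊢_v}(A)^gp` is `log(p)^k`, `k ∈ ℤ`;
* `cls_eq_divB_of_isometry_two` — an object `(A, α)` of `C_v` carrying an ISOMETRIC endomorphism of Frobenius degree `2`
  has `α = Div_B(u) ∈ ℤ·log(p)` ([FrdI] Thm. 5.2 (i) relation `2α + 0 = α + Div_B(u)`);
* `cdashToC_obj_cls` / `cdashToC_obj_eq` — `C⊢_v ⊆ C_v` on objects: `(A, log(p)^k) ↦ (A, log(p)^k)`;
  `mem_essImage_of_cls_eq_zpow` — an object of `C_v` whose class lies in `ℤ·log(p)` lies in the (essential) image.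

Consumed by `GoodLocalFrobenioidOfKitQpCdash.lean` (Ex. 3.3 (iii)(d) HOLDS at `ofKitQp p`). Nothing of the disputed series
is asserted; typed ≠ proved.
-/

noncomputable section

namespace Literature.IUT.HodgeTheaters

namespace GoodLocalFrobenioid

open CategoryTheory Opposite Literature.AlgebraicGeometry.Frobenioids Literature.AlgebraicGeometry.Frobenioids.PadicFrd

variable (p : ℕ) [Fact p.Prime]

/-! ### `log(p)` in `Φ_{C_v}` and in `Φ_{C⊢_v}` -/

/-- `log(p) = ord(p) ⊗ 1 ∈ Φ_{C_v}(A) = ord(ℤ_p^▷)^pf` ([IUTchI] Ex. 3.3 (ii): "write `log(p_v)` for the element `p_v`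
… considered additively"). [cite: MochizukiFrdII2008, Ex 1.1 (ii) p.8] -/
def pGen (A : Discrete PUnit.{1}) : (qpPerfDatum p).Φ.obj (op A) :=
  ⟨primGen (𝟭 (Discrete PUnit.{1}) ⋙ qpBase p) A, Realification.of_mem_perf _⟩

/-- `log(p) ∈ Φ_{C⊢_v}(A) = ℕ·ord(p)` (abc-iut-L1-t4's `Datum.logp`). [cite: MochizukiFrdII2008, Ex 1.1 (ii) p.8] -/
abbrev logpQ (A : Discrete PUnit.{1}) : (qpPrimDatum p).Φ.obj (op A) :=
  Datum.logp (qpBase p) (fun _ => isPadicLocal_qpFld p : ∀ A : Discrete PUnit.{1}, ((qpBase p).obj A).IsPadicLocal)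
    inferInstance isTotallyEpimorphic_discretePUnit (op A)

/-- Under `ι : Φ_{C_v} ↪ Φ₀`, `log(p) ↦ ord(p) ⊗ 1`. [cite: MochizukiFrdII2008, Ex 1.1 (ii) p.8] -/
theorem ιHom_pGen (A : Discrete PUnit.{1}) :
    (qpPerfDatum p).ιHom A (pGen p A) =
      Realification.of (OrdInt ℚ_[p]) (Associates.mk ⟨((p : ℕ) : ℚ_[p]), PadicFrd.p_mem_intNonzero p⟩) := rfl

/-- The morphism of data `(Φ⊢, B⊢) → (Φ, B)` underlying `C⊢_v ⊆ C_v` (abc-iut-L1-t4's `Datum.primToPerf` at `ℚ_p`).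
[cite: MochizukiFrdII2008, Ex 1.1 (ii) p.8] -/
abbrev primToPerfQ : ModelFrobenioid.DataHom (qpPrimDatum p).divB
    (Datum.perf (qpBase p) (fun _ => isPadicLocal_qpFld p : ∀ A : Discrete PUnit.{1}, ((qpBase p).obj A).IsPadicLocal)
      inferInstance isTotallyEpimorphic_discretePUnit).divB :=
  Datum.primToPerf (qpBase p) (fun _ => isPadicLocal_qpFld p : ∀ A : Discrete PUnit.{1}, ((qpBase p).obj A).IsPadicLocal)
    inferInstance isTotallyEpimorphic_discretePUnit

/-- `η(log(p)) = log(p)`: the inclusion `Φ_{C⊢_v} ↪ Φ_{C_v}` on the generator. [cite: MochizukiFrdII2008, Ex 1.1 (ii) p.8] -/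
theorem inclusionη_logpQ (A : Discrete PUnit.{1}) :
    ((primToPerfQ p).η.app (op A)).hom (logpQ p A) = pGen p A := rfl

/-! ### `ℚ_pˣ = p^ℤ × ℤ_pˣ` on divisors -/

/-- `Div₀(x) = Div₀(p)^{v_p(x)}` in `Φ₀(ℚ_p)^gp` for `x ∈ ℚ_pˣ`: `x · p^{-v_p(x)}` is a unit of `ℤ_p`, killed by `Div₀`
(abc-iut-L1-d10's `ker_divZeroHom_eq_unitSubgroup`). [cite: MochizukiFrdII2008, Ex 1.1 (i) p.7] -/
theorem divZeroHom_units_qp (x : ℚ_[p]ˣ) :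
    divZeroHom ℚ_[p] x = divZeroHom ℚ_[p] (pU p) ^ Multiplicative.toAdd (unitsVal p x) := by
  set k : ℤ := Multiplicative.toAdd (unitsVal p x) with hk
  have hy : x * (pU p) ^ (-k) ∈ unitSubgroup ℚ_[p] := by
    rw [mem_unitSubgroup_iff]
    have hne : ((x * pU p ^ (-k) : ℚ_[p]ˣ) : ℚ_[p]) ≠ 0 := Units.ne_zero _
    rw [PadicFrd.padic_eq_one_iff p hne]
    have hv : unitsVal p (x * pU p ^ (-k)) = 1 := by
      rw [map_mul, map_zpow, unitsVal_pU, ← ofAdd_zsmul, smul_eq_mul, mul_one, hk, ofAdd_neg, ofAdd_toAdd,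
        mul_inv_cancel]
    exact toAdd_eq_zero.mpr hv
  have hker : x * (pU p) ^ (-k) ∈ (divZeroHom ℚ_[p]).ker := by
    rw [ker_divZeroHom_eq_unitSubgroup (p := p) (K := ℚ_[p]) fun _ _ => Iff.rfl]
    exact hy
  rw [MonoidHom.mem_ker, map_mul, map_zpow, zpow_neg, mul_inv_eq_one] at hker
  exact hker

/-- `Div₀(p) = ι^gp(log(p))` (as elements of `Φ₀(ℚ_p)^gp`). [cite: MochizukiFrdII2008, Ex 1.1 (ii) p.8] -/
theorem divZeroHom_pU (A : Discrete PUnit.{1}) :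
    divZeroHom ℚ_[p] (pU p) = MonGp.map ((qpPerfDatum p).ιHom A) (Algebra.GrothendieckGroup.of (pGen p A)) := by
  rw [MonGp.map_of]
  exact divZeroHom_intNonzeroToUnits ℚ_[p] ⟨((p : ℕ) : ℚ_[p]), PadicFrd.p_mem_intNonzero p⟩

/-- `Div₀(p) = ι⊢^gp(log(p))` for the absolutely primitive datum. [cite: MochizukiFrdII2008, Ex 1.1 (ii) p.8] -/
theorem divZeroHom_pU' (A : Discrete PUnit.{1}) :
    divZeroHom ℚ_[p] (pU p) = MonGp.map ((qpPrimDatum p).ιHom A) (Algebra.GrothendieckGroup.of (logpQ p A)) := by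
  rw [MonGp.map_of]
  exact divZeroHom_intNonzeroToUnits ℚ_[p] ⟨((p : ℕ) : ℚ_[p]), PadicFrd.p_mem_intNonzero p⟩

/-! ### The divisor lattice `Div_B(B(A)) = ℤ·log(p)` -/

/-- **`Div_B(u) = log(p)^{v_p(u|_{K^×})}`** for every `u ∈ B(A) = ℚ_pˣ ×_{Φ₀^gp} Φ_{C_v}^gp`: by the cartesian square
`Div₀(u|_{K^×}) = ι^gp(Div_B(u))`, `ℚ_pˣ = p^ℤ × ℤ_pˣ`, and injectivity of `ι^gp`. [cite: MochizukiFrdII2008, Ex 1.1 (ii) p.8] -/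
theorem divB_eq_pGen_zpow (A : Discrete PUnit.{1}) (u : (qpPerfDatum p).B.obj (op A)) :
    Literature.AlgebraicGeometry.Frobenioids.divB (qpPerfDatum p).Φ (qpPerfDatum p).B (qpPerfDatum p).divB (op A) u =
      Algebra.GrothendieckGroup.of (pGen p A) ^ Multiplicative.toAdd (unitsVal p (rfQ p A u)) := by
  haveI : IsCancelMul (Realification (OrdInt ((qpPerfDatum p).fld A))) := isCancelMul_realification _
  apply MonGp.map_injective ((qpPerfDatum p).ιHom A) ((qpPerfDatum p).ιHom_injective A)
  rw [← (qpPerfDatum p).divZeroHom_resK A u, map_zpow, ← divZeroHom_pU]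
  exact divZeroHom_units_qp p (rfQ p A u)

/-- The same for `C⊢_v`: `Div_B⊢(u) = log(p)^{v_p(u|_{K^×})}` in `Φ_{C⊢_v}(A)^gp`. [cite: MochizukiFrdII2008, Ex 1.1 (ii) p.8] -/
theorem divB_eq_logpQ_zpow (A : Discrete PUnit.{1}) (u : (qpPrimDatum p).B.obj (op A)) :
    Literature.AlgebraicGeometry.Frobenioids.divB (qpPrimDatum p).Φ (qpPrimDatum p).B (qpPrimDatum p).divB (op A) u =
      Algebra.GrothendieckGroup.of (logpQ p A) ^ Multiplicative.toAdd (unitsVal p (rfQ' p A u)) := by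
  haveI : IsCancelMul (Realification (OrdInt ((qpPrimDatum p).fld A))) := isCancelMul_realification _
  apply MonGp.map_injective ((qpPrimDatum p).ιHom A) ((qpPrimDatum p).ιHom_injective A)
  rw [← (qpPrimDatum p).divZeroHom_resK A u, map_zpow, ← divZeroHom_pU']
  exact divZeroHom_units_qp p (rfQ' p A u)

/-- Every element of a Grothendieck group is a quotient of two elements of the monoid. [folklore] -/
private theorem exists_eq_of_div_of' {M : Type*} [CommMonoid M] (g : Algebra.GrothendieckGroup M) :
    ∃ x y : M, g = Algebra.GrothendieckGroup.of x / Algebra.GrothendieckGroup.of y := by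
  induction g using Localization.induction_on with
  | H q =>
    refine ⟨q.1, q.2, eq_div_iff_mul_eq'.mpr ?_⟩
    show Localization.mk q.1 q.2 * Localization.mk (q.2 : M) 1 = Localization.mk q.1 1
    rw [Localization.mk_mul, Localization.mk_eq_mk_iff, Localization.r_iff_exists]
    exact ⟨1, by simp [mul_comm]⟩

/-- **`Φ_{C⊢_v}(A)^gp = log(p)^ℤ`**: every element of the groupification of `ℕ·ord(p)` is a power of `log(p)`.
[cite: MochizukiFrdII2008, Ex 1.1 (ii) p.8] -/
theorem prim_gp_eq_zpow (A : Discrete PUnit.{1}) (c : Algebra.GrothendieckGroup ((qpPrimDatum p).Φ.obj (op A))) :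
    ∃ k : ℤ, c = Algebra.GrothendieckGroup.of (logpQ p A) ^ k := by
  obtain ⟨x, y, rfl⟩ := exists_eq_of_div_of' c
  obtain ⟨i, hi⟩ := (Submonoid.mem_powers_iff _ _).mp x.2
  obtain ⟨j, hj⟩ := (Submonoid.mem_powers_iff _ _).mp y.2
  have hx : x = logpQ p A ^ i := Subtype.ext (by rw [← hi]; rfl)
  have hy : y = logpQ p A ^ j := Subtype.ext (by rw [← hj]; rfl)
  refine ⟨(i : ℤ) - (j : ℤ), ?_⟩
  rw [hx, hy, map_pow, map_pow, zpow_sub, zpow_natCast, zpow_natCast, div_eq_mul_inv]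

/-! ### Objects: classes, isometries of Frobenius degree `2`, and the image of `C⊢_v ⊆ C_v` -/

/-- An object `(A, α)` of `C_v` with an ISOMETRIC endomorphism (`Div = 0`) of Frobenius degree `2` has
`α = Div_B(u_ψ)`: relation (d) of [FrdI] Thm. 5.2 (i) reads `2α + 0 = α + Div_B(u_ψ)` over the one-object base.
[cite: MochizukiFrdI2008, Thm. 5.2(i) p.100] -/
theorem cls_eq_divB_of_isometry_two {Y : (qpPerfDatum p).frobenioid} (ψ : Y ⟶ Y)
    (hdeg : ModelFrobenioid.degFr ψ = 2) (hdiv : ModelFrobenioid.div ψ = 1) :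
    Y.cls = Literature.AlgebraicGeometry.Frobenioids.divB (qpPerfDatum p).Φ (qpPerfDatum p).B (qpPerfDatum p).divB
      (op Y.base) (ModelFrobenioid.unit ψ) := by
  have h := ModelFrobenioid.rel ψ
  have hb : ModelFrobenioid.baseMap ψ = 𝟙 Y.base := Subsingleton.elim _ _
  rw [hdeg, hdiv, hb, map_one, mul_one, pullGp_id] at h
  have h2 : ((2 : ℕ+) : ℕ) = 2 := rfl
  rw [h2, pow_two] at h
  exact mul_left_cancel h

/-- `C⊢_v ⊆ C_v` on classes: the class of the image of `(A, c)` is `η^gp(c)` (the transport along the trivial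
counit and the identity base change of `ofKit` act trivially). [cite: MochizukiFrdII2008, Ex 1.1 (ii) p.8] -/
theorem cdashToC_obj_cls (X : (qpPrimDatum p).frobenioid) :
    ((ofKitQp p).CdashToC.obj X).cls = gpApp (primToPerfQ p).η (op X.base) X.cls := by
  change MonGp.map ((qpPerfDatum p).Φ.map (𝟙 X.base).op).hom (gpApp (primToPerfQ p).η (op X.base) X.cls) = _
  rw [op_id, CategoryTheory.Functor.map_id, CommMonCat.hom_id, MonGp.map_id]
  rfl

/-- `C⊢_v ⊆ C_v` is the identity on base objects. [cite: MochizukiFrdII2008, Ex 1.1 (ii) p.8] -/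
theorem cdashToC_obj_base (X : (qpPrimDatum p).frobenioid) : ((ofKitQp p).CdashToC.obj X).base = X.base := rfl

/-- `η^gp(log(p)^k) = log(p)^k`. [cite: MochizukiFrdII2008, Ex 1.1 (ii) p.8] -/
theorem gpApp_η_logpQ_zpow (A : Discrete PUnit.{1}) (k : ℤ) :
    gpApp (primToPerfQ p).η (op A) (Algebra.GrothendieckGroup.of (logpQ p A) ^ k) =
      Algebra.GrothendieckGroup.of (pGen p A) ^ k := by
  rw [map_zpow, gpApp_of]
  rfl

/-- **`C⊢_v ⊆ C_v` on objects**: `(A, log(p)^k) ↦ (A, log(p)^k)`. [cite: MochizukiFrdII2008, Ex 1.1 (ii) p.8] -/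
theorem cdashToC_obj_eq (A : Discrete PUnit.{1}) (k : ℤ) :
    (ofKitQp p).CdashToC.obj (⟨A, Algebra.GrothendieckGroup.of (logpQ p A) ^ k⟩ : (qpPrimDatum p).frobenioid) =
      (⟨A, Algebra.GrothendieckGroup.of (pGen p A) ^ k⟩ : (qpPerfDatum p).frobenioid) := by
  have hc := cdashToC_obj_cls p ⟨A, Algebra.GrothendieckGroup.of (logpQ p A) ^ k⟩
  rw [gpApp_η_logpQ_zpow] at hc
  change (⟨A, ((ofKitQp p).CdashToC.obj ⟨A, Algebra.GrothendieckGroup.of (logpQ p A) ^ k⟩).cls⟩ :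
      (qpPerfDatum p).frobenioid) = _
  rw [hc]

/-- **An object of `C_v` whose class lies in the lattice `ℤ·log(p)` is in the (essential) image of `C⊢_v ⊆ C_v`.**
[cite: MochizukiFrdII2008, Ex 1.1 (ii) p.8] -/
theorem mem_essImage_of_cls_eq_zpow (Y : (qpPerfDatum p).frobenioid) (k : ℤ)
    (hY : Y.cls = Algebra.GrothendieckGroup.of (pGen p Y.base) ^ k) :
    (ofKitQp p).CdashToC.essImage Y := by
  obtain ⟨b, c⟩ := Y
  change c = Algebra.GrothendieckGroup.of (pGen p b) ^ k at hY
  subst hY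
  exact ⟨⟨b, Algebra.GrothendieckGroup.of (logpQ p b) ^ k⟩, ⟨eqToIso (cdashToC_obj_eq p b k)⟩⟩

end GoodLocalFrobenioid

end Literature.IUT.HodgeTheaters
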